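import Summits.BirchSwinnertonDyer.BirchSwinnertonDyer.Theorems.ManinLocalTwoThreeMinimalThreeTorsionIntegral
import Summits.BirchSwinnertonDyer.Rank1Residual.ManinAdditive.UDCKummerLineK
import HarnessLib

/-!
# (INT)_K, arithmetic of the `K`-point: a `3`-torsion point with RATIONAL abscissa read on the minimal model
(route `ManinLocalTwoThree`, crux C3 `ManinPrimeToThreeAtNine` stmt-BirchSwinnertonDyer-22968; cell bsd-f2-manin, prover seat p3 gen 16 —
piece (INT)_K of -an g39's `K`-rational UDC line `UDCKummerLineK` (RES₃♭ split), p2 g18's interface; `--supports` 22968)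

For `IsShortThreeTorsionC W c X₀ Y₀` (`X₀ ∈ ℚ`, `Y₀ ∈ ℂ`, a point of order `3` of `E_{W,c}` over `ℂ` with rational abscissa) and
`c ≠ 0`, with `x_T = X₀/c² − b₂/12 ∈ ℚ`, `y_T = Y₀/c³ − (a₁x_T + a₃)/2 ∈ ℂ`, `λ = α/c − a₁/2 ∈ ℂ` (`α = tangentSlopeC`):

* `y_ne_zero`, `tangentSlopeC_sq` (`α² = 3X₀`), `exists_ratCast_eq_sq` (`Y₀² ∈ ℚ`);
* `isRoot_Ψ₃_of_isRoot_shortModel` (`Ψ₃` covariance `c⁸`), `exists_intCast_eq_three_mul` (`3x_T ∈ ℤ`: `Ψ₃` has leading coefficient `3`;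
  for a NON-rational `Y₀` the denominator `3` does occur — `μ₃`-type points);
* `equationC` (`W`'s equation at `(x_T, y_T)` over `ℂ`), `flexC` (`λ² + a₁λ = a₂ + 3x_T`);
* `isIntegral_flexSlopeC` (`λ` is an algebraic INTEGER), `isIntegral_nine_mul_yC` (`9·y_T` is an algebraic integer).

HONEST FRAMING.  Elementary arithmetic of Weierstrass equations; nothing about (INT)_K's conclusion, C3, Manin's conjecture or BSD is
proved here.  No definitions, no sorry.
[cite: SilvermanAEC2009, III.1 (changes of variables), III.2.3 (duplication formula) and Ex. 3.7 (division polynomials); VII.3.4 (shape)]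
-/

set_option autoImplicit false
-- lint-debt: the directory name repeats the summit name (sibling precedent `ManinLocalTwoThreeMinimalThreeTorsionIntegral.lean`)
set_option linter.dupNamespace false

noncomputable section

open Polynomial WeierstrassCurve
open Summit.BirchSwinnertonDyer.Rank1Residual.ManinAdditive.CuspidalKummer
open Summit.BirchSwinnertonDyer.Rank1Residual.ManinAdditive.CuspidalKummerThree
open Summit.BirchSwinnertonDyer.Rank1Residual.ManinAdditive.UDCKummerLineK
open Summit.BirchSwinnertonDyer.BirchSwinnertonDyer.Theorems.ManinLocalTwoThree.MinimalThreeTorsion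
  (den_dvd_three_of_psiThree_eq_zero)

namespace Summit.BirchSwinnertonDyer.BirchSwinnertonDyer.Theorems.ManinLocalTwoThree.MinimalThreeTorsionC

variable {W : WeierstrassCurve ℚ} {c : ℤ} {X₀ : ℚ} {Y₀ : ℂ}

/-! ## §1 The short model over `ℂ` -/

/-- The short-model equation at a point of `IsShortThreeTorsionC`: `Y₀² = X₀³ + a₄X₀ + a₆`. [folklore] -/
theorem equation_of_isShortThreeTorsionC (hT : IsShortThreeTorsionC W c X₀ Y₀) :
    Y₀ ^ 2 = (X₀ : ℂ) ^ 3 + ((shortModel W c).a₄ : ℂ) * X₀ + ((shortModel W c).a₆ : ℂ) := by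
  have h := (Affine.equation_iff _ _).mp hT.1.1
  have h1 : (shortModel W c).a₁ = 0 := rfl
  have h2 : (shortModel W c).a₂ = 0 := rfl
  have h3 : (shortModel W c).a₃ = 0 := rfl
  simp only [map_a₁, map_a₂, map_a₃, map_a₄, map_a₆, h1, h2, h3, map_zero, zero_mul, add_zero, eq_ratCast] at h
  linear_combination h

/-- `Ψ₃(X₀) = 0` on the short model, expanded. [folklore] -/
theorem psiThree_eq_zero_of_isShortThreeTorsionC (hT : IsShortThreeTorsionC W c X₀ Y₀) :
    3 * (X₀ : ℂ) ^ 4 + 6 * ((shortModel W c).a₄ : ℂ) * X₀ ^ 2 + 12 * ((shortModel W c).a₆ : ℂ) * X₀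
      - ((shortModel W c).a₄ : ℂ) ^ 2 = 0 := by
  have h := congrArg (fun q : ℚ ↦ (q : ℂ)) ((isRoot_Ψ₃_shortModel_iff W c X₀).mp hT.2)
  push_cast at h
  linear_combination h

/-- **`Y₀ ≠ 0`** (a point of order `3` is not `2`-torsion: `Y₀ = 0` would make `(3X₀² + a₄)² = −Ψ₃(X₀) + 12X₀Y₀² = 0`, a singular point).
[folklore] -/
theorem y_ne_zero (hT : IsShortThreeTorsionC W c X₀ Y₀) : Y₀ ≠ 0 := by
  intro hY
  have heq := equation_of_isShortThreeTorsionC hT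
  have hΨ := psiThree_eq_zero_of_isShortThreeTorsionC hT
  have hns := ((Affine.nonsingular_iff _ _).mp hT.1).2
  have h1 : (shortModel W c).a₁ = 0 := rfl
  have h2 : (shortModel W c).a₂ = 0 := rfl
  have h3 : (shortModel W c).a₃ = 0 := rfl
  subst hY
  simp only [map_a₁, map_a₂, map_a₃, map_a₄, h1, h2, h3, map_zero, eq_ratCast, zero_mul, mul_zero, sub_zero, neg_zero,
    add_zero] at hns
  have hsq : (3 * (X₀ : ℂ) ^ 2 + ((shortModel W c).a₄ : ℂ)) ^ 2 = 0 := by linear_combination -hΨ - (12 * (X₀ : ℂ)) * heq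
  have h0 : 3 * (X₀ : ℂ) ^ 2 + ((shortModel W c).a₄ : ℂ) = 0 := pow_eq_zero_iff two_ne_zero |>.mp hsq
  rcases hns with hx | hy
  · exact hx (by linear_combination -h0)
  · exact hy rfl

/-- **The flex identity `α² = 3X₀`** (`(3X₀² + a₄)² − 12X₀Y₀² = −Ψ₃(X₀) = 0`). [cite: SilvermanAEC2009, III.2.3] -/
theorem tangentSlopeC_sq (hT : IsShortThreeTorsionC W c X₀ Y₀) : tangentSlopeC W c X₀ Y₀ ^ 2 = 3 * (X₀ : ℂ) := by
  have heq := equation_of_isShortThreeTorsionC hT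
  have hΨ := psiThree_eq_zero_of_isShortThreeTorsionC hT
  have hY := y_ne_zero hT
  rw [tangentSlopeC, div_pow, div_eq_iff (pow_ne_zero 2 (mul_ne_zero two_ne_zero hY))]
  linear_combination -hΨ - (12 * (X₀ : ℂ)) * heq

/-- **`Y₀² ∈ ℚ`** (`= X₀³ + a₄X₀ + a₆`). [folklore] -/
theorem exists_ratCast_eq_sq (hT : IsShortThreeTorsionC W c X₀ Y₀) :
    ∃ r : ℚ, (r : ℂ) = Y₀ ^ 2 :=
  ⟨X₀ ^ 3 + (shortModel W c).a₄ * X₀ + (shortModel W c).a₆, by rw [equation_of_isShortThreeTorsionC hT]; push_cast; ring⟩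

/-! ## §2 The abscissa on `W`: `3x_T ∈ ℤ` -/

/-- **`Ψ₃` is covariant of weight `c⁸`**: `x_T = X₀/c² − b₂/12` is a root of `W.Ψ₃` (only the abscissa is used). [cite: SilvermanAEC2009, Ex. 3.7 and III.1] -/
theorem isRoot_Ψ₃_of_isRoot_shortModel (W : WeierstrassCurve ℚ) (hc : c ≠ 0) (hΨ : (shortModel W c).Ψ₃.IsRoot X₀) :
    W.Ψ₃.IsRoot (X₀ / (c : ℚ) ^ 2 - W.b₂ / 12) := by
  set x := X₀ / (c : ℚ) ^ 2 - W.b₂ / 12 with hx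
  have hc' : (c : ℚ) ≠ 0 := by exact_mod_cast hc
  have hX : X₀ = (c : ℚ) ^ 2 * (x + W.b₂ / 12) := MinimalThreeTorsion.shortX_eq W hc X₀
  have hΨ' := (isRoot_Ψ₃_shortModel_iff W c X₀).mp hΨ
  have h4 : (shortModel W c).a₄ = -((c : ℚ) ^ 4 * W.c₄ / 48) := rfl
  have h6 : (shortModel W c).a₆ = -((c : ℚ) ^ 6 * W.c₆ / 864) := rfl
  rw [h4, h6] at hΨ'
  rw [isRoot_Ψ₃_iff]
  have key : (c : ℚ) ^ 8 * (3 * x ^ 4 + W.b₂ * x ^ 3 + 3 * W.b₄ * x ^ 2 + 3 * W.b₆ * x + W.b₈)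
      = 3 * X₀ ^ 4 + 6 * -((c : ℚ) ^ 4 * W.c₄ / 48) * X₀ ^ 2 + 12 * -((c : ℚ) ^ 6 * W.c₆ / 864) * X₀
        - (-((c : ℚ) ^ 4 * W.c₄ / 48)) ^ 2 := by
    rw [hX]
    simp only [WeierstrassCurve.c₄, WeierstrassCurve.c₆, WeierstrassCurve.b₂, WeierstrassCurve.b₄, WeierstrassCurve.b₆,
      WeierstrassCurve.b₈]
    ring
  rw [hΨ', mul_eq_zero] at key
  rcases key with h0 | h0
  · exact absurd ((pow_eq_zero_iff (by norm_num)).mp h0) hc'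
  · exact h0

/-- **`3x_T ∈ ℤ`**: on an integral model the abscissa of a point of order `3` has denominator dividing `3` (`Ψ₃` has leading coefficient `3`).
[cite: SilvermanAEC2009, Ex. 3.7 and VII.3.4 (shape)] -/
theorem exists_intCast_eq_three_mul (W : WeierstrassCurve ℚ) [hW : W.IsIntegral ℤ] (hc : c ≠ 0) (hΨ : (shortModel W c).Ψ₃.IsRoot X₀) :
    ∃ m : ℤ, (m : ℚ) = 3 * (X₀ / (c : ℚ) ^ 2 - W.b₂ / 12) := by
  set x := X₀ / (c : ℚ) ^ 2 - W.b₂ / 12 with hx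
  obtain ⟨V, hV⟩ := hW.integral
  have ha₁ : W.a₁ = (V.a₁ : ℚ) := by rw [hV]; rfl
  have ha₂ : W.a₂ = (V.a₂ : ℚ) := by rw [hV]; rfl
  have ha₃ : W.a₃ = (V.a₃ : ℚ) := by rw [hV]; rfl
  have ha₄ : W.a₄ = (V.a₄ : ℚ) := by rw [hV]; rfl
  have ha₆ : W.a₆ = (V.a₆ : ℚ) := by rw [hV]; rfl
  have hb₂ : W.b₂ = (V.b₂ : ℚ) := by simp only [WeierstrassCurve.b₂, ha₁, ha₂]; push_cast; ring
  have hb₄ : W.b₄ = (V.b₄ : ℚ) := by simp only [WeierstrassCurve.b₄, ha₁, ha₃, ha₄]; push_cast; ring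
  have hb₆ : W.b₆ = (V.b₆ : ℚ) := by simp only [WeierstrassCurve.b₆, ha₃, ha₆]; push_cast; ring
  have hb₈ : W.b₈ = (V.b₈ : ℚ) := by
    simp only [WeierstrassCurve.b₈, ha₁, ha₂, ha₃, ha₄, ha₆]; push_cast; ring
  have hΨ' := (isRoot_Ψ₃_iff W x).mp (isRoot_Ψ₃_of_isRoot_shortModel W hc hΨ)
  rw [hb₂, hb₄, hb₆, hb₈] at hΨ'
  have hden := den_dvd_three_of_psiThree_eq_zero hΨ'
  have hxd : x = x.num / x.den := (Rat.num_div_den x).symm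
  rcases (Nat.dvd_prime Nat.prime_three).mp hden with h1 | h3
  · refine ⟨3 * x.num, ?_⟩
    conv_rhs => rw [hxd, h1]
    push_cast; ring
  · refine ⟨x.num, ?_⟩
    conv_rhs => rw [hxd, h3]
    push_cast; ring

/-! ## §3 The point and the flex slope on `W`, over `ℂ` -/

/-- **`W`'s equation at `(x_T, y_T)` over `ℂ`** (`c⁶·(W's equation) = E_{W,c}'s equation`, `c₄ = b₂² − 24b₄`, `c₆ = −b₂³ + 36b₂b₄ − 216b₆`).
[cite: SilvermanAEC2009, III.1 (Table 3.1)] -/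
theorem equationC (hc : c ≠ 0) (hT : IsShortThreeTorsionC W c X₀ Y₀) :
    (Y₀ / (c : ℂ) ^ 3 - ((W.a₁ : ℂ) * ((X₀ / (c : ℚ) ^ 2 - W.b₂ / 12 : ℚ) : ℂ) + W.a₃) / 2) ^ 2
      + (W.a₁ : ℂ) * ((X₀ / (c : ℚ) ^ 2 - W.b₂ / 12 : ℚ) : ℂ)
          * (Y₀ / (c : ℂ) ^ 3 - ((W.a₁ : ℂ) * ((X₀ / (c : ℚ) ^ 2 - W.b₂ / 12 : ℚ) : ℂ) + W.a₃) / 2)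
      + (W.a₃ : ℂ) * (Y₀ / (c : ℂ) ^ 3 - ((W.a₁ : ℂ) * ((X₀ / (c : ℚ) ^ 2 - W.b₂ / 12 : ℚ) : ℂ) + W.a₃) / 2)
      = ((X₀ / (c : ℚ) ^ 2 - W.b₂ / 12 : ℚ) : ℂ) ^ 3 + (W.a₂ : ℂ) * ((X₀ / (c : ℚ) ^ 2 - W.b₂ / 12 : ℚ) : ℂ) ^ 2
        + (W.a₄ : ℂ) * ((X₀ / (c : ℚ) ^ 2 - W.b₂ / 12 : ℚ) : ℂ) + (W.a₆ : ℂ) := by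
  have hc' : (c : ℂ) ≠ 0 := by exact_mod_cast hc
  have heqS := equation_of_isShortThreeTorsionC hT
  have h4 : (shortModel W c).a₄ = -((c : ℚ) ^ 4 * W.c₄ / 48) := rfl
  have h6 : (shortModel W c).a₆ = -((c : ℚ) ^ 6 * W.c₆ / 864) := rfl
  rw [h4, h6] at heqS
  set x : ℂ := ((X₀ / (c : ℚ) ^ 2 - W.b₂ / 12 : ℚ) : ℂ) with hx
  set y : ℂ := Y₀ / (c : ℂ) ^ 3 - ((W.a₁ : ℂ) * x + W.a₃) / 2 with hy
  have hX : (X₀ : ℂ) = (c : ℂ) ^ 2 * (x + (W.b₂ : ℂ) / 12) := by rw [hx]; push_cast; field_simp; ring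
  have hY : Y₀ = (c : ℂ) ^ 3 * (y + ((W.a₁ : ℂ) * x + W.a₃) / 2) := by rw [hy]; field_simp; ring
  have key : (c : ℂ) ^ 6 * (y ^ 2 + (W.a₁ : ℂ) * x * y + (W.a₃ : ℂ) * y - (x ^ 3 + (W.a₂ : ℂ) * x ^ 2 + (W.a₄ : ℂ) * x + W.a₆))
      = Y₀ ^ 2 - ((X₀ : ℂ) ^ 3 + ((-((c : ℚ) ^ 4 * W.c₄ / 48) : ℚ) : ℂ) * X₀ + ((-((c : ℚ) ^ 6 * W.c₆ / 864) : ℚ) : ℂ)) := by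
    rw [hY, hX]
    simp only [WeierstrassCurve.c₄, WeierstrassCurve.c₆, WeierstrassCurve.b₂, WeierstrassCurve.b₄, WeierstrassCurve.b₆]
    push_cast
    ring
  rw [heqS, sub_self, mul_eq_zero] at key
  rcases key with h0 | h0
  · exact absurd ((pow_eq_zero_iff (by norm_num)).mp h0) hc'
  · linear_combination h0

/-- **The flex identity on `W` over `ℂ`: `λ² + a₁λ = a₂ + 3x_T`** (`λ = α/c − a₁/2`, `α² = 3X₀`). [cite: SilvermanAEC2009, III.2.3] -/
theorem flexC (hc : c ≠ 0) (hT : IsShortThreeTorsionC W c X₀ Y₀) :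
    (tangentSlopeC W c X₀ Y₀ / c - (W.a₁ : ℂ) / 2) ^ 2 + (W.a₁ : ℂ) * (tangentSlopeC W c X₀ Y₀ / c - (W.a₁ : ℂ) / 2)
      = (W.a₂ : ℂ) + 3 * ((X₀ / (c : ℚ) ^ 2 - W.b₂ / 12 : ℚ) : ℂ) := by
  have hc' : (c : ℂ) ≠ 0 := by exact_mod_cast hc
  have hα := tangentSlopeC_sq hT
  have key : (c : ℂ) ^ 2 * ((tangentSlopeC W c X₀ Y₀ / c - (W.a₁ : ℂ) / 2) ^ 2
      + (W.a₁ : ℂ) * (tangentSlopeC W c X₀ Y₀ / c - (W.a₁ : ℂ) / 2) - ((W.a₂ : ℂ) + 3 * ((X₀ / (c : ℚ) ^ 2 - W.b₂ / 12 : ℚ) : ℂ)))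
      = tangentSlopeC W c X₀ Y₀ ^ 2 - 3 * (X₀ : ℂ) := by
    simp only [WeierstrassCurve.b₂]
    push_cast
    field_simp
    ring
  rw [hα, sub_self, mul_eq_zero] at key
  rcases key with h0 | h0
  · exact absurd ((pow_eq_zero_iff (by norm_num)).mp h0) hc'
  · exact sub_eq_zero.mp h0

/-! ## §4 Algebraic integrality of `λ` and `9y_T` -/

/-- A root of a monic integer quadratic is integral over `ℤ`. [folklore] -/
theorem isIntegral_of_monic_quadratic {K : Type*} [CommRing K] {x : K} (P Q : ℤ) (h : x ^ 2 + (P : K) * x + (Q : K) = 0) :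
    IsIntegral ℤ x := by
  refine ⟨X ^ 2 + Polynomial.C P * X + Polynomial.C Q, ?_, ?_⟩
  · monicity <;> norm_num
  · rw [eval₂_add, eval₂_add, eval₂_pow, eval₂_mul, eval₂_C, eval₂_X, eval₂_C]
    simpa using h

/-- **`λ` is an algebraic integer**: root of `X² + a₁X − (a₂ + 3x_T) ∈ ℤ[X]`. [cite: SilvermanAEC2009, VII.3.4 (shape) and III.2.3] -/
theorem isIntegral_flexSlopeC (W : WeierstrassCurve ℚ) [hW : W.IsIntegral ℤ] (hc : c ≠ 0) (hT : IsShortThreeTorsionC W c X₀ Y₀) :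
    IsIntegral ℤ (tangentSlopeC W c X₀ Y₀ / c - (W.a₁ : ℂ) / 2) := by
  obtain ⟨V, hV⟩ := hW.integral
  have ha₁ : W.a₁ = (V.a₁ : ℚ) := by rw [hV]; rfl
  have ha₂ : W.a₂ = (V.a₂ : ℚ) := by rw [hV]; rfl
  obtain ⟨m, hm⟩ := exists_intCast_eq_three_mul W hc hT.2
  have hflex := flexC hc hT
  have hmC : (m : ℂ) = 3 * ((X₀ / (c : ℚ) ^ 2 - W.b₂ / 12 : ℚ) : ℂ) := by
    have := congrArg (fun q : ℚ ↦ (q : ℂ)) hm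
    simpa only [Rat.cast_intCast, Rat.cast_mul, Rat.cast_ofNat] using this
  refine isIntegral_of_monic_quadratic V.a₁ (-(V.a₂ + m)) ?_
  have e1 : (W.a₁ : ℂ) = (V.a₁ : ℂ) := by rw [ha₁]; push_cast; rfl
  have e2 : (W.a₂ : ℂ) = (V.a₂ : ℂ) := by rw [ha₂]; push_cast; rfl
  push_cast
  linear_combination hflex - (tangentSlopeC W c X₀ Y₀ / c - (W.a₁ : ℂ) / 2) * e1 + e2 - hmC

/-- **`9y_T` is an algebraic integer**: `(9y_T)² + (3a₁(3x_T) + 9a₃)(9y_T) = 3(3x_T)³ + 9a₂(3x_T)² + 27a₄(3x_T) + 81a₆`.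
[cite: SilvermanAEC2009, VII.3.4 (shape)] -/
theorem isIntegral_nine_mul_yC (W : WeierstrassCurve ℚ) [hW : W.IsIntegral ℤ] (hc : c ≠ 0) (hT : IsShortThreeTorsionC W c X₀ Y₀) :
    IsIntegral ℤ (9 * (Y₀ / (c : ℂ) ^ 3 - ((W.a₁ : ℂ) * ((X₀ / (c : ℚ) ^ 2 - W.b₂ / 12 : ℚ) : ℂ) + W.a₃) / 2)) := by
  obtain ⟨V, hV⟩ := hW.integral
  have ha₁ : W.a₁ = (V.a₁ : ℚ) := by rw [hV]; rfl
  have ha₂ : W.a₂ = (V.a₂ : ℚ) := by rw [hV]; rfl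
  have ha₃ : W.a₃ = (V.a₃ : ℚ) := by rw [hV]; rfl
  have ha₄ : W.a₄ = (V.a₄ : ℚ) := by rw [hV]; rfl
  have ha₆ : W.a₆ = (V.a₆ : ℚ) := by rw [hV]; rfl
  obtain ⟨m, hm⟩ := exists_intCast_eq_three_mul W hc hT.2
  have heq := equationC hc hT
  set x : ℂ := ((X₀ / (c : ℚ) ^ 2 - W.b₂ / 12 : ℚ) : ℂ) with hx
  have hmC : (m : ℂ) = 3 * x := by rw [hx, ← Rat.cast_intCast, hm]; push_cast; ring
  have e1 : (W.a₁ : ℂ) = (V.a₁ : ℂ) := by rw [ha₁]; push_cast; rfl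
  have e2 : (W.a₂ : ℂ) = (V.a₂ : ℂ) := by rw [ha₂]; push_cast; rfl
  have e3 : (W.a₃ : ℂ) = (V.a₃ : ℂ) := by rw [ha₃]; push_cast; rfl
  have e4 : (W.a₄ : ℂ) = (V.a₄ : ℂ) := by rw [ha₄]; push_cast; rfl
  have e6 : (W.a₆ : ℂ) = (V.a₆ : ℂ) := by rw [ha₆]; push_cast; rfl
  rw [e1, e2, e3, e4, e6] at heq
  rw [e1, e3]
  refine isIntegral_of_monic_quadratic (3 * V.a₁ * m + 9 * V.a₃) (-(3 * m ^ 3 + 9 * V.a₂ * m ^ 2 + 27 * V.a₄ * m + 81 * V.a₆)) ?_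
  push_cast
  rw [hmC]
  linear_combination 81 * heq

end Summit.BirchSwinnertonDyer.BirchSwinnertonDyer.Theorems.ManinLocalTwoThree.MinimalThreeTorsionC

end
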